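import Literature.MathematicalPhysics.QuantumLattice.InfVolFermionStateTorusLimitLocalStability
import Literature.MathematicalPhysics.QuantumManyBody.StateRelaxationKKT
import HarnessLib

/-!
# The state-optimality (KKT) block is nonnegative in torus-limit ground states of the Hubbard model

Topic `Literature/MathematicalPhysics/QuantumLattice` (family `hubbard`). Combination of two tree
results, PROVED (no definition, no named fact): the local ground-state inequality of torus-limit states
(`InfVolFermionState.IsTorusLimitOf.localStability`: `ω(Ã⋆ [H_{thicken Λ 1}, Ã]) ≥ 0` for every local
`A ∈ 𝔄_Λ` conserving the local particle number and `S^z`; Bratteli–Robinson II Prop. 5.3.19/5.3.25)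
and weak duality for the PSD-weighted KKT element (`StateRelaxation.re_map_kktForm_nonneg`:
`G ⪰ 0` and the one-generator inequality on the span of the generators give
`Re ω(kktForm h G B) ≥ 0`; Araújo–Klep–Garner–Vértesi–Navascués Prop. 11) yield: for every torus limit
`ω` of translation averages of sector ground states of `hubbardTorus d (Ls j) t U`, every finite region
`Λ ⊂ ℤ^d`, every finite family of generators `B_b ∈ 𝔄_Λ` commuting with the local `N̂` and `S^z`, and
every positive semidefinite multiplier `G`,

  `0 ≤ Re ω( Σ_ab G_ab • (B̃_a⋆ (H_{thicken Λ 1} B̃_b − B̃_b H_{thicken Λ 1})) )`,  `B̃_b = Γ(incl) B_b`.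

This is the state-side validity of the `kkt` block of the cell's chain / square-lattice relaxations
(sr-mbsolver TL-FORMULATION §A (K0); engine block kind `kkt`) on the thermodynamic-limit state class of
`HubbardChainTorusLimitState` ("(I)"): with it a certificate's KKT summand, like its Pauli–Markov
summand (`Summit.Ventures.CertifiedManyBodySolver.Transport.PauliMarkov`), may be moved into the
objective and discharged in the limit state.

## References
* O. Bratteli, D. W. Robinson, *Operator Algebras and Quantum Statistical Mechanics 2*, 2nd ed.
  (Springer 1997), Prop. 5.3.19 and Prop. 5.3.25 (ground states: `-i ω(A⋆ δ(A)) ≥ 0`).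
  [cite: BratteliRobinsonII1997, Prop. 5.3.25]
* M. Araújo, I. Klep, A. J. P. Garner, T. Vértesi, M. Navascués, *First-order optimality conditions
  for non-commutative optimization problems*, arXiv:2311.18707, §3.2 Prop. 11 (state optimality /
  PSD-weighted form). [cite: AraujoEtAl2023, §3.2 Prop. 11]
-/

noncomputable section

namespace Literature.MathematicalPhysics.QuantumLattice

open Matrix Finset HubbardWave0 Filter Topology Literature.Probability.LatticeModels
open Literature.MathematicalPhysics.QuantumManyBody.StateRelaxation
open scoped ComplexOrder

variable {d : ℕ} (t U : ℝ)

/-- A linear combination of generators conserving the local particle number and `S^z` conserves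
them. [cite: AraujoEtAl2023, §3.2 Prop. 11] -/
theorem commute_sum_smul_of_commute {Λ : Finset (Site d)} {m : Type*} [Fintype m] (B : m → FermionOp Λ)
    (C : FermionOp Λ) (hB : ∀ b, Commute (B b) C) (w : m → ℂ) : Commute (∑ b, w b • B b) C :=
  Commute.sum_left _ _ _ fun b _ => (hB b).smul_left (w b)

/-- **The KKT block is nonnegative in torus-limit ground states.** Let `ω` be a torus limit of the
translation averages of sector ground states `ψ_{Ls j}` of `hubbardTorus d (Ls j) t U` (sectors
`(N_j, S^z = M_j)`), `Ls → ∞`; let `B_b ∈ 𝔄_Λ` (finitely many) commute with the local `N̂` and `S^z`,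
and `G ⪰ 0`. Then `0 ≤ Re ω(kktForm H_{thicken Λ 1} G B̃)`, `B̃_b = B_b` embedded in `𝔄_{thicken Λ 1}`.
[cite: BratteliRobinsonII1997, Prop. 5.3.25] [cite: AraujoEtAl2023, §3.2 Prop. 11] -/
theorem InfVolFermionState.IsTorusLimitOf.re_expect_kktForm_nonneg {ω : InfVolFermionState d}
    {ψ : ∀ L, Fock (Orb (FermionTorus d L))} {Ls : ℕ → ℕ} (h : ω.IsTorusLimitOf ψ Ls)
    (hLs : Tendsto Ls atTop atTop) {N : ℕ → ℕ} {M : ℕ → ℝ}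
    (hgs : ∀ j, IsGroundStateInSector (hubbardTorus d (Ls j) t U) (N j) (M j) (ψ (Ls j)))
    {Λ : Finset (Site d)} {m : Type*} [Fintype m] [DecidableEq m] {G : Matrix m m ℂ} (hG : G.PosSemidef)
    (B : m → FermionOp Λ) (hBN : ∀ b, Commute (B b) totalNumber) (hBS : ∀ b, Commute (B b) HubbardWave0.spinZ) :
    0 ≤ (ω.expect (thicken Λ 1)
      (kktForm ((hubbardFermionInteraction d t U).localHamiltonian (thicken Λ 1)) G
        (fun b => fermionEmbed (PolySite.incl (subset_thicken Λ 1)) (B b)))).re := by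
  refine re_map_kktForm_nonneg (ω.expect (thicken Λ 1)) _ hG _ fun w => ?_
  have hsum : ∑ b, w b • fermionEmbed (PolySite.incl (subset_thicken Λ 1)) (B b) =
      fermionEmbed (PolySite.incl (subset_thicken Λ 1)) (∑ b, w b • B b) := by
    rw [map_sum]
    exact Finset.sum_congr rfl fun b _ => (map_smul _ _ _).symm
  rw [hsum, Matrix.star_eq_conjTranspose]
  exact (Complex.nonneg_iff.1 (h.localStability t U hLs hgs (commute_sum_smul_of_commute B _ hBN w)
    (commute_sum_smul_of_commute B _ hBS w))).1

/-- The same in `ComplexOrder` (`ω(kktForm …)` is real and nonnegative).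
[cite: BratteliRobinsonII1997, Prop. 5.3.25] [cite: AraujoEtAl2023, §3.2 Prop. 11] -/
theorem InfVolFermionState.IsTorusLimitOf.expect_kktForm_nonneg {ω : InfVolFermionState d}
    {ψ : ∀ L, Fock (Orb (FermionTorus d L))} {Ls : ℕ → ℕ} (h : ω.IsTorusLimitOf ψ Ls)
    (hLs : Tendsto Ls atTop atTop) {N : ℕ → ℕ} {M : ℕ → ℝ}
    (hgs : ∀ j, IsGroundStateInSector (hubbardTorus d (Ls j) t U) (N j) (M j) (ψ (Ls j)))
    {Λ : Finset (Site d)} {m : Type*} [Fintype m] [DecidableEq m] {G : Matrix m m ℂ} (hG : G.PosSemidef)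
    (B : m → FermionOp Λ) (hBN : ∀ b, Commute (B b) totalNumber) (hBS : ∀ b, Commute (B b) HubbardWave0.spinZ) :
    0 ≤ ω.expect (thicken Λ 1)
      (kktForm ((hubbardFermionInteraction d t U).localHamiltonian (thicken Λ 1)) G
        (fun b => fermionEmbed (PolySite.incl (subset_thicken Λ 1)) (B b))) := by
  refine map_kktForm_nonneg (ω.expect (thicken Λ 1)) _ hG _ fun w => ?_
  have hsum : ∑ b, w b • fermionEmbed (PolySite.incl (subset_thicken Λ 1)) (B b) =
      fermionEmbed (PolySite.incl (subset_thicken Λ 1)) (∑ b, w b • B b) := by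
    rw [map_sum]
    exact Finset.sum_congr rfl fun b _ => (map_smul _ _ _).symm
  rw [hsum, Matrix.star_eq_conjTranspose]
  exact h.localStability t U hLs hgs (commute_sum_smul_of_commute B _ hBN w) (commute_sum_smul_of_commute B _ hBS w)

/-- **Slack form for certificates**: for a KKT summand `K = kktForm H_{thicken Λ 1} G B̃` with
`G ⪰ 0` and conserving generators, `Re ω(X − K) ≤ Re ω(X)` in every torus-limit ground state `ω`
(the block may be moved into the objective and dropped). [cite: AraujoEtAl2023, §3.2 Prop. 11] -/
theorem InfVolFermionState.IsTorusLimitOf.re_expect_sub_kktForm_le {ω : InfVolFermionState d}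
    {ψ : ∀ L, Fock (Orb (FermionTorus d L))} {Ls : ℕ → ℕ} (h : ω.IsTorusLimitOf ψ Ls)
    (hLs : Tendsto Ls atTop atTop) {N : ℕ → ℕ} {M : ℕ → ℝ}
    (hgs : ∀ j, IsGroundStateInSector (hubbardTorus d (Ls j) t U) (N j) (M j) (ψ (Ls j)))
    {Λ : Finset (Site d)} {m : Type*} [Fintype m] [DecidableEq m] {G : Matrix m m ℂ} (hG : G.PosSemidef)
    (B : m → FermionOp Λ) (hBN : ∀ b, Commute (B b) totalNumber) (hBS : ∀ b, Commute (B b) HubbardWave0.spinZ)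
    (X : FermionOp (thicken Λ 1)) :
    (ω.expect (thicken Λ 1) (X - kktForm ((hubbardFermionInteraction d t U).localHamiltonian (thicken Λ 1)) G
        (fun b => fermionEmbed (PolySite.incl (subset_thicken Λ 1)) (B b)))).re ≤
      (ω.expect (thicken Λ 1) X).re := by
  rw [map_sub, Complex.sub_re]
  linarith [h.re_expect_kktForm_nonneg t U hLs hgs hG B hBN hBS]

end Literature.MathematicalPhysics.QuantumLattice

end
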